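import Summits.ValiantsHypothesis.ValiantsHypothesis.Theorems.MonotoneRestorationOrbitRestorationQPSymmetricTerms
import HarnessLib

/-!
# Route MonotoneRestoration — crux `OrbitRestorationQP` (stmt-ValiantsHypothesis-18293), line `depth-three-rung`:
# GROUPED DEPTH-THREE REPRESENTATIONS RESTORE (the three landed strata of `A_∞` combined term-group-wise)

The three landed per-level strata of the rung `A_∞` — TAME terms (`TameStratum.qpOrbitRestorable_of_tameTerms`),
SMALL BOX VOLUME (`Residue.qpOrbitRestorable_of_smallBox`) and TERM-WISE MATRIX SYMMETRY
(`SymmetricTerms.qpOrbitRestorable_of_symmetricTerms`) — each ask the WHOLE representation to be of one kind, so a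
mixed representation such as `Σ_i Π_j x_ij + Π_{P<Q} (x_P − x_Q)` (tame row products plus the matrix-symmetric,
twisted, large-box Vandermonde of all entries, `n` even) escapes all three although each invariant piece is
restorable.  This file combines them GROUP-WISE:

* `reindex_terms` — bookkeeping: a family of scaled affine-product terms indexed by any finite type is re-indexed by
  `Fin k` with all per-term data and the box volume preserved;
* `qpOrbitRestorable_of_groupedTerms` — **GROUPED TERMS RESTORE (per level, uniform constant)**: for every `c`
  there is `c'` such that `p = Σ_{i<k} C(a i) · Π (L i)` (affine factors, `|L i| ≤ n^c + c`) is
  `QPOrbitRestorable c' n p` as soon as the terms are PARTITIONED (`g : Fin k → Fin m`, any `m`) into groups each of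
  which is (T) diagonally invariant with all its factor multisets tame (`≤ 2^((log₂ n + c)^c)` translates), or
  (S) made of matrix-symmetric terms, or (B) matrix-symmetric with total box volume `≤ n^c + c`
  (group sums via `Finset.sum_fiberwise`, then `ValueOrbit.qpOrbitRestorable_finset_sum`);
* `sigmaPiSigmaValue_of_wildResidue₄` — **`A_∞` ⟸ THE GROUPED RESIDUE**: the registered stub (verbatim) follows
  from the per-level statement about matrix-symmetric `p ∈ PDClass 1 n c` admitting NO cheap depth-three
  representation with such a grouping.  What is left is cancellation ACROSS kinds inside one diagonally invariant
  group that cannot be split — the genuinely wild representations.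

Everything is proved; the stub stays open; VP ≠ VNP is not touched. [folklore]

## References
* A. Dawar, G. Wilsenach, *Symmetric arithmetic circuits*, ToC 21 (2025), §3.3. [DawarWilsenach2025]
-/

noncomputable section

open scoped Classical

-- `Summit.ValiantsHypothesis.ValiantsHypothesis.…` is the tree's single-conjunct layout (Sub = Summit).
set_option linter.dupNamespace false

namespace Summit.ValiantsHypothesis.ValiantsHypothesis.Theorems

namespace OrbitRestorationQPDepthThreeRung

namespace GroupedTerms

open MvPolynomial Equiv Finset Literature.Computability.AlgebraicComplexity Restorable

variable {n : ℕ}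

/-! ### Re-indexing -/

/-- **Re-indexing by `Fin`.**  A finite family of terms is re-indexed by `Fin (card ι)` along `Fintype.equivFin`,
preserving the sum, every per-term property, and the total box volume. [folklore] -/
theorem reindex_terms {ι : Type} [Fintype ι] (a : ι → ℂ) (L : ι → Multiset (MvPolynomial (Fin n × Fin n) ℂ)) :
    ∃ (a' : Fin (Fintype.card ι) → ℂ) (L' : Fin (Fintype.card ι) → Multiset (MvPolynomial (Fin n × Fin n) ℂ)),
      (∑ i, MvPolynomial.C (a i) * (L i).prod) = ∑ i', MvPolynomial.C (a' i') * (L' i').prod ∧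
      (∀ P : ℂ → Multiset (MvPolynomial (Fin n × Fin n) ℂ) → Prop, (∀ i, P (a i) (L i)) → ∀ i', P (a' i') (L' i')) ∧
      (∑ i, ∏ ℓ ∈ (L i).toFinset, ((L i).count ℓ + 1)) = ∑ i', ∏ ℓ ∈ (L' i').toFinset, ((L' i').count ℓ + 1) := by
  set e := Fintype.equivFin ι
  refine ⟨fun i' => a (e.symm i'), fun i' => L (e.symm i'), ?_, fun P hP i' => hP _, ?_⟩
  · exact (Fintype.sum_equiv e _ _ fun i => by simp [e]).trans rfl
  · exact Fintype.sum_equiv e _ _ fun i => by simp [e]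

/-! ### Grouped terms restore -/

/-- **GROUPED DEPTH-THREE REPRESENTATIONS RESTORE (per level, uniform constant).**  For every `c` there is `c'`
such that at every level `n`: if `p = Σ_{i<k} C(a i) · Π (L i)` with every `L i` a multiset of `≤ n^c + c` polynomials
of total degree `≤ 1`, and the terms are partitioned by `g : Fin k → Fin m` into groups each of which is
(T) diagonally invariant (`ren σ` fixes the group sum) with all factor multisets of the group having
`≤ 2^((log₂ n + c)^c)` diagonal translates, or (S) made of matrix-symmetric terms, or (B) with matrix-symmetric group
sum and total box volume `≤ n^c + c`, then `QPOrbitRestorable c' n p`. [folklore; cite: DawarWilsenach2025, §3.3] -/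
theorem qpOrbitRestorable_of_groupedTerms (c : ℕ) : ∃ c' : ℕ, ∀ (n : ℕ) (p : MvPolynomial (Fin n × Fin n) ℂ)
    (k : ℕ) (a : Fin k → ℂ) (L : Fin k → Multiset (MvPolynomial (Fin n × Fin n) ℂ)) (m : ℕ) (g : Fin k → Fin m),
    (∀ i, ∀ ℓ ∈ L i, ℓ.totalDegree ≤ 1) → (∀ i, Multiset.card (L i) ≤ n ^ c + c) →
    p = ∑ i, MvPolynomial.C (a i) * (L i).prod →
    (∀ j : Fin m,
      ((∀ σ : Perm (Fin n), ren σ (∑ i ∈ univ.filter (fun i => g i = j), MvPolynomial.C (a i) * (L i).prod) =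
          ∑ i ∈ univ.filter (fun i => g i = j), MvPolynomial.C (a i) * (L i).prod) ∧
        ∀ i, g i = j →
          (Set.range fun σ : Perm (Fin n) => (L i).map (ren σ)).ncard ≤ 2 ^ ((Nat.log 2 n + c) ^ c)) ∨
      (∀ i, g i = j → ∀ σ τ : Perm (Fin n), rename (fun q : Fin n × Fin n => (σ q.1, τ q.2))
          (MvPolynomial.C (a i) * (L i).prod) = MvPolynomial.C (a i) * (L i).prod) ∨
      ((∀ σ τ : Perm (Fin n), rename (fun q : Fin n × Fin n => (σ q.1, τ q.2))
          (∑ i ∈ univ.filter (fun i => g i = j), MvPolynomial.C (a i) * (L i).prod) =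
          ∑ i ∈ univ.filter (fun i => g i = j), MvPolynomial.C (a i) * (L i).prod) ∧
        (∑ i ∈ univ.filter (fun i => g i = j), ∏ ℓ ∈ (L i).toFinset, ((L i).count ℓ + 1)) ≤ n ^ c + c)) →
    QPOrbitRestorable c' n p := by
  obtain ⟨cS, hS⟩ := SymmetricTerms.qpOrbitRestorable_of_symmetricTerms c
  obtain ⟨cB, hB⟩ := Residue.qpOrbitRestorable_of_smallBox c
  refine ⟨max (2 * c + 7) (max cS cB) + 3, fun n p k a L m g hdeg hcard hp hgrp => ?_⟩
  -- the group sums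
  set G : Fin m → MvPolynomial (Fin n × Fin n) ℂ :=
    fun j => ∑ i ∈ univ.filter (fun i => g i = j), MvPolynomial.C (a i) * (L i).prod with hG
  have hpG : p = ∑ j, G j := by
    rw [hp, hG]
    exact (Finset.sum_fiberwise_of_maps_to (s := univ) (t := univ) (g := g) (fun i _ => mem_univ _)
      (fun i => MvPolynomial.C (a i) * (L i).prod)).symm
  rw [hpG]
  refine ValueOrbit.qpOrbitRestorable_finset_sum (Finset.univ : Finset (Fin m)) G fun j _ => ?_
  -- one group: re-index its fibre by `Fin`
  let ι := {i : Fin k // g i = j}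
  obtain ⟨a', L', hsum, hprop, hvol⟩ := reindex_terms (n := n) (fun i : ι => a i.1) (fun i : ι => L i.1)
  have hGj : G j = ∑ i', MvPolynomial.C (a' i') * (L' i').prod := by
    rw [← hsum, hG]
    simp only
    rw [Finset.sum_subtype (univ.filter fun i => g i = j) (p := fun i => g i = j) (by simp)]
  have hvolj : (∑ i ∈ univ.filter (fun i => g i = j), ∏ ℓ ∈ (L i).toFinset, ((L i).count ℓ + 1)) =
      ∑ i', ∏ ℓ ∈ (L' i').toFinset, ((L' i').count ℓ + 1) := by
    rw [← hvol, Finset.sum_subtype (univ.filter fun i => g i = j) (p := fun i => g i = j) (by simp)]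
  have hdeg' : ∀ i', ∀ ℓ ∈ L' i', ℓ.totalDegree ≤ 1 :=
    hprop (fun _ M => ∀ ℓ ∈ M, ℓ.totalDegree ≤ 1) fun i => hdeg i.1
  have hcard' : ∀ i', Multiset.card (L' i') ≤ n ^ c + c :=
    hprop (fun _ M => Multiset.card M ≤ n ^ c + c) fun i => hcard i.1
  rcases hgrp j with ⟨hinv, htame⟩ | hsymm | ⟨hms, hbox⟩
  · -- (T) tame group
    refine qpOrbitRestorable_mono (le_max_left _ _) ?_
    have horb' : ∀ i', (Set.range fun σ : Perm (Fin n) => (L' i').map (ren σ)).ncard ≤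
        2 ^ ((Nat.log 2 n + c) ^ c) :=
      hprop (fun _ M => (Set.range fun σ : Perm (Fin n) => M.map (ren σ)).ncard ≤ 2 ^ ((Nat.log 2 n + c) ^ c))
        fun i => htame i.1 i.2
    have hinv' : ∀ σ : Perm (Fin n), ren σ (G j) = G j := hinv
    exact TameStratum.qpOrbitRestorable_of_tameTerms c a' L' hdeg' hcard' horb' hGj hinv'
  · -- (S) matrix-symmetric terms
    refine qpOrbitRestorable_mono ((le_max_left _ _).trans (le_max_right _ _)) ?_
    have hsymm' : ∀ i', ∀ σ τ : Perm (Fin n), rename (fun q : Fin n × Fin n => (σ q.1, τ q.2))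
        (MvPolynomial.C (a' i') * (L' i').prod) = MvPolynomial.C (a' i') * (L' i').prod :=
      hprop (fun x M => ∀ σ τ : Perm (Fin n), rename (fun q : Fin n × Fin n => (σ q.1, τ q.2))
        (MvPolynomial.C x * M.prod) = MvPolynomial.C x * M.prod) fun i => hsymm i.1 i.2
    exact hS n (G j) _ a' L' hdeg' hcard' hGj hsymm'
  · -- (B) small box volume
    refine qpOrbitRestorable_mono ((le_max_right _ _).trans (le_max_right _ _)) ?_
    refine hB n (G j) hms ⟨_, a', L', hdeg', ?_, hGj⟩
    rw [← hvolj]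
    exact hbox

/-! ### The residue, carved group-wise -/

/-- **`A_∞` ⟸ THE GROUPED RESIDUE.**  Suppose (`hW`) that for every `c` there is `c'` such that every `p` at level
`n` which is matrix-symmetric, lies in `PDClass (fun _ => 1) n c`, and admits NO depth-three representation
`p = Σ_{i<k} C(a i) · Π (L i)` (affine factors, all `|L i| ≤ n^c + c`) whose terms can be partitioned into groups of
the kinds (T)/(S)/(B) of `qpOrbitRestorable_of_groupedTerms`, is `QPOrbitRestorable c' n p`.  Then the registered
stub `stub_sigmaPiSigmaValue` (conclusion verbatim) holds. [folklore] -/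
theorem sigmaPiSigmaValue_of_wildResidue₄
    (hW : ∀ c : ℕ, ∃ c' : ℕ, ∀ (n : ℕ) (p : MvPolynomial (Fin n × Fin n) ℂ),
      (∀ σ τ : Perm (Fin n), rename (fun q : Fin n × Fin n => (σ q.1, τ q.2)) p = p) →
      PDClass (fun _ => 1) n c p →
      (¬ ∃ (k : ℕ) (a : Fin k → ℂ) (L : Fin k → Multiset (MvPolynomial (Fin n × Fin n) ℂ)) (m : ℕ)
          (g : Fin k → Fin m),
          (∀ i, ∀ ℓ ∈ L i, ℓ.totalDegree ≤ 1) ∧ (∀ i, Multiset.card (L i) ≤ n ^ c + c) ∧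
          p = ∑ i, MvPolynomial.C (a i) * (L i).prod ∧
          ∀ j : Fin m,
            ((∀ σ : Perm (Fin n), ren σ (∑ i ∈ univ.filter (fun i => g i = j), MvPolynomial.C (a i) * (L i).prod) =
                ∑ i ∈ univ.filter (fun i => g i = j), MvPolynomial.C (a i) * (L i).prod) ∧
              ∀ i, g i = j →
                (Set.range fun σ : Perm (Fin n) => (L i).map (ren σ)).ncard ≤ 2 ^ ((Nat.log 2 n + c) ^ c)) ∨
            (∀ i, g i = j → ∀ σ τ : Perm (Fin n), rename (fun q : Fin n × Fin n => (σ q.1, τ q.2))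
                (MvPolynomial.C (a i) * (L i).prod) = MvPolynomial.C (a i) * (L i).prod) ∨
            ((∀ σ τ : Perm (Fin n), rename (fun q : Fin n × Fin n => (σ q.1, τ q.2))
                (∑ i ∈ univ.filter (fun i => g i = j), MvPolynomial.C (a i) * (L i).prod) =
                ∑ i ∈ univ.filter (fun i => g i = j), MvPolynomial.C (a i) * (L i).prod) ∧
              (∑ i ∈ univ.filter (fun i => g i = j), ∏ ℓ ∈ (L i).toFinset, ((L i).count ℓ + 1)) ≤
                n ^ c + c)) →
      QPOrbitRestorable c' n p) :
    ∀ f : (n : ℕ) → MvPolynomial (Fin n × Fin n) ℂ, IsMatrixSymmetric f →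
      (∃ c : ℕ, ∀ n : ℕ, PDClass (fun _ => 1) n c (f n)) →
      ∃ c : ℕ, ∀ n : ℕ, QPOrbitRestorable c n (f n) := by
  rintro f hsym ⟨c, hc⟩
  obtain ⟨cG, hG⟩ := qpOrbitRestorable_of_groupedTerms c
  obtain ⟨cW, hcW⟩ := hW c
  refine ⟨max cG cW, fun n => ?_⟩
  have hsym_n : ∀ σ τ : Perm (Fin n), rename (fun q : Fin n × Fin n => (σ q.1, τ q.2)) (f n) = f n :=
    fun σ τ => hsym n σ τ
  by_cases hg : ∃ (k : ℕ) (a : Fin k → ℂ) (L : Fin k → Multiset (MvPolynomial (Fin n × Fin n) ℂ)) (m : ℕ)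
      (g : Fin k → Fin m),
      (∀ i, ∀ ℓ ∈ L i, ℓ.totalDegree ≤ 1) ∧ (∀ i, Multiset.card (L i) ≤ n ^ c + c) ∧
      f n = ∑ i, MvPolynomial.C (a i) * (L i).prod ∧
      ∀ j : Fin m,
        ((∀ σ : Perm (Fin n), ren σ (∑ i ∈ univ.filter (fun i => g i = j), MvPolynomial.C (a i) * (L i).prod) =
            ∑ i ∈ univ.filter (fun i => g i = j), MvPolynomial.C (a i) * (L i).prod) ∧
          ∀ i, g i = j →
            (Set.range fun σ : Perm (Fin n) => (L i).map (ren σ)).ncard ≤ 2 ^ ((Nat.log 2 n + c) ^ c)) ∨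
        (∀ i, g i = j → ∀ σ τ : Perm (Fin n), rename (fun q : Fin n × Fin n => (σ q.1, τ q.2))
            (MvPolynomial.C (a i) * (L i).prod) = MvPolynomial.C (a i) * (L i).prod) ∨
        ((∀ σ τ : Perm (Fin n), rename (fun q : Fin n × Fin n => (σ q.1, τ q.2))
            (∑ i ∈ univ.filter (fun i => g i = j), MvPolynomial.C (a i) * (L i).prod) =
            ∑ i ∈ univ.filter (fun i => g i = j), MvPolynomial.C (a i) * (L i).prod) ∧
          (∑ i ∈ univ.filter (fun i => g i = j), ∏ ℓ ∈ (L i).toFinset, ((L i).count ℓ + 1)) ≤ n ^ c + c)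
  · obtain ⟨k, a, L, m, g, hdeg, hcard, hfn, hgrp⟩ := hg
    exact qpOrbitRestorable_mono (le_max_left _ _) (hG n (f n) k a L m g hdeg hcard hfn hgrp)
  · exact qpOrbitRestorable_mono (le_max_right _ _) (hcW n (f n) hsym_n (hc n) hg)

end GroupedTerms

end OrbitRestorationQPDepthThreeRung

end Summit.ValiantsHypothesis.ValiantsHypothesis.Theorems

end
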